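import Summits.BirchSwinnertonDyer.Rank1Residual.X11b.Three.HsiehDescentOfRangeReciprocity
import Summits.BirchSwinnertonDyer.Rank1Residual.X11b.Three.LocalValueReciprocityOfValueReciprocity
import HarnessLib

/-!
# X11b @ `p = 3`, K4″ comparison: value reciprocity LOCAL AT 3 (VR_loc) IMPLIES its restriction to
# the node's κ-RANGE (VR_loc|κ)

HONEST FRAMING (cell `b2b-bsdres`, run/shared/lean/b2b/bsd-rank1-residual/, verbatim in every
file): the goal of the cell is to DELETE the COMBINATION-SHAPED residual classes of the
Birch–Swinnerton-Dyer formula for ALL analytic-rank `≤ 1` elliptic curves over `ℚ` — assembled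
STRICTLY from published theorems — so that the rank-`≤ 1` remainder becomes exactly the
CONSTRUCTION-SHAPED classes, which are TYPED, NOT attempted. This is not "finishing BSD". Team N8/O2
(X11b at `3`); K4″ (x11b3-lead GEN 9, R10-24 (1) option; K4′ = R10-15), seat `b2b-bsdres-x11b3-p7`
(gen. 6). **WORDING OF RECORD (H45, R10-32, binding): K4″ RE-EXPRESSES (t) ⟸ (VR_loc|κ) = value
reciprocity LOCAL AT 3 ON THE NODE'S OWN RANGE — OPEN labelled hypothesis, implied by (VR_loc)
(restriction: THIS file's kernel lemma), hence by (VR) (K4′-b); its B-half NECESSARY for (t) by S30-e;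
A-half not shown necessary; converses not claimed; nothing discharged; nothing booked; no `_holds`.**
Both sides are LABELLED HYPOTHESES — NOT published numbered theorems; this file proves the IMPLICATION
and discharges neither.
The node `Three.HsiehDescentAt₃` is UNCHANGED — nothing appended, no `_holds`; O2 OPEN / N8
CONSTRUCTION; nothing booked; no mark / label / count / tier moved. THEOREMS ONLY (no def, no fact).

## What this file proves

* **`Three.rangeValueReciprocity_of_localValueReciprocity : hVRloc → hVRlocκ`** — binder shuffling:
  `hVRloc` (K4′-a's binder, p289959, VERBATIM) asserts the two clauses at EVERY range point; `hVRlocκ`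
  (K4″'s binder VERBATIM: the extra datum `κ`, the extra guard `κ.IsAnticyclotomic`, and in both
  clauses the node's range antecedents `∀ r, IsPAdicAvatarOf ι' χ r → FactorsThroughZp κ r →`) only
  at the points with a 3-adic avatar factoring through `κ`. One semantic delta beyond pure
  restriction (x11b3-r1's gate note A3, intended): in `hVRlocκ` the period `Ω` is chosen AFTER `κ`, so
  it may depend on `κ` — exactly what the node allows; the converse (VR_loc|κ) ⟹ (VR_loc) is NOT
  claimed.
* Two closing `example`s (no declarations; the gate forbids restating landed theorems): K4′-a's
  statement `hVRloc → HsiehDescentAt₃ W` (p289959) as K4″ ∘ (this lemma), and K4's terminal form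
  `hVR → HsiehDescentAt₃ W` (p287576) as K4″ ∘ (this lemma) ∘ K4′-b — the ladder
  (VR) ⟹ (VR_loc) ⟹ (VR_loc|κ) ⟹ (t) composed in one kernel term each.

References: OWNERS R10-15, R10-24; x11b3-p7 `s25/S30-SIGMA-SITES.md`; x11b3-r1 `S30E-EXPECTED-r1.lean`.
-/

noncomputable section

open scoped NumberField
open NumberField IsDedekindDomain Field WeierstrassCurve
open Literature.NumberTheory.GaloisRepresentations Literature.NumberTheory.EllipticCurves
open Literature.NumberTheory.EllipticCurves.ModularForms

namespace Summit.BirchSwinnertonDyer.Rank1Residual.X11b.Three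

variable (W : WeierstrassCurve ℚ)

/-- **K4″ comparison: (VR_loc) implies (VR_loc|κ)** — restricting both clauses of value reciprocity
local at `3` to the node's κ-range (and adding the datum `κ` with its guard) only weakens the
hypothesis. `hVRloc` = K4′-a's binder VERBATIM; the conclusion = K4″'s binder `hVRlocκ` VERBATIM. Both
are LABELLED HYPOTHESES, neither is discharged; the converse is not claimed. WORDING OF RECORD: K4″
RE-EXPRESSES (t) ⟸ (VR_loc|κ). [cite: Hsieh2014, Thm. 1 (arXiv:1112.1580 pp. 3–4)] -/
theorem rangeValueReciprocity_of_localValueReciprocity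
    (hVRloc :
  ∀ (ι' : PadicAlgCl 3 ≃+* ℂ) (K : Type) [Field K] [NumberField K] (𝔭 : HeightOneSpectrum (𝓞 K))
      {N : ℕ} [NeZero N] (f : CuspForm (CongruenceSubgroup.Gamma0 N) 2),
      IsNewformOf W f → W.conductorNorm ℤ = N → IsImaginaryQuadratic K → SatisfiesHeegnerHypothesis N K →
      ((Ideal.span {(3 : ℤ)}).primesOver (𝓞 K)).ncard = 2 → ((3 : ℕ) : 𝓞 K) ∈ 𝔭.asIdeal →
      𝔭.asIdeal.ramificationIdx (𝓞 ℚ) = 1 → 𝔭.asIdeal.inertiaDeg (𝓞 ℚ) = 1 →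
      (∀ (w : InfinitePlace K) (k : 𝓞 K), k ∈ 𝔭.asIdeal ↔ ‖ι'.symm (w.embedding (k : K))‖ < 1) →
      ∃ Ω : ℂ, Ω ≠ 0 ∧
        -- (VR-A_𝔭) cocycle clause on the decomposition group at 𝔭 (transported by ι′); NO support condition
        (∀ (τ : PadicAlgCl 3 ≃ₐ[ℚ_[3]] PadicAlgCl 3) (σ : ℂ ≃ₐ[ℚ] ℂ),
          (∀ z : PadicAlgCl 3, σ (ι' z) = ι' (τ z)) →
          ∃ (c d : ℂ) (e : HeightOneSpectrum (𝓞 K) →₀ ℤ), c ≠ 0 ∧ d ≠ 0 ∧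
            ∀ (χ : HeckeCharacter K) (n : ℕ), 0 < n →
              (∀ v : HeightOneSpectrum (𝓞 K), χ.IsUnramifiedAt v) →
              ∀ hχ : χ.HasInfinityType (fun _ ↦ (n : ℤ)) (fun _ ↦ -(n : ℤ)),
                σ (bdpInterpolationValue 3 f 𝔭 χ n Ω) =
                  d * c ^ n * (e.prod fun v k ↦ (hχ.autConj σ).valueAtUniformizer v ^ k) *
                    bdpInterpolationValue 3 f 𝔭 (hχ.autConj σ) n Ω) ∧
        -- (VR-B_I) exactness clause on the inertia subgroup (T6's inertia predicate verbatim)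
        (∀ (τ : PadicAlgCl 3 ≃ₐ[ℚ_[3]] PadicAlgCl 3) (σ : ℂ ≃ₐ[ℚ] ℂ),
          (∀ ζ : PadicAlgCl 3, (∃ m : ℕ, 0 < m ∧ ¬ 3 ∣ m ∧ ζ ^ m = 1) → τ ζ = ζ) →
          (∀ z : PadicAlgCl 3, σ (ι' z) = ι' (τ z)) →
          ∀ (χ : HeckeCharacter K) (n : ℕ), 0 < n →
            (∀ v : HeightOneSpectrum (𝓞 K), χ.IsUnramifiedAt v) →
            ∀ hχ : χ.HasInfinityType (fun _ ↦ (n : ℤ)) (fun _ ↦ -(n : ℤ)),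
              σ (bdpInterpolationValue 3 f 𝔭 χ n Ω) =
                bdpInterpolationValue 3 f 𝔭 (hχ.autConj σ) n Ω)) :
  ∀ (ι' : PadicAlgCl 3 ≃+* ℂ) (K : Type) [Field K] [NumberField K] (𝔭 : HeightOneSpectrum (𝓞 K))
      (κ : ZpExtension K 3) {N : ℕ} [NeZero N] (f : CuspForm (CongruenceSubgroup.Gamma0 N) 2),
      IsNewformOf W f → W.conductorNorm ℤ = N → IsImaginaryQuadratic K → SatisfiesHeegnerHypothesis N K →
      ((Ideal.span {(3 : ℤ)}).primesOver (𝓞 K)).ncard = 2 → ((3 : ℕ) : 𝓞 K) ∈ 𝔭.asIdeal →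
      𝔭.asIdeal.ramificationIdx (𝓞 ℚ) = 1 → 𝔭.asIdeal.inertiaDeg (𝓞 ℚ) = 1 →
      (∀ (w : InfinitePlace K) (k : 𝓞 K), k ∈ 𝔭.asIdeal ↔ ‖ι'.symm (w.embedding (k : K))‖ < 1) →
      κ.IsAnticyclotomic →
      ∃ Ω : ℂ, Ω ≠ 0 ∧
        -- (VR-A_𝔭)|κ: cocycle clause on the decomposition group at 𝔭, on the κ-RANGE only
        (∀ (τ : PadicAlgCl 3 ≃ₐ[ℚ_[3]] PadicAlgCl 3) (σ : ℂ ≃ₐ[ℚ] ℂ),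
          (∀ z : PadicAlgCl 3, σ (ι' z) = ι' (τ z)) →
          ∃ (c d : ℂ) (e : HeightOneSpectrum (𝓞 K) →₀ ℤ), c ≠ 0 ∧ d ≠ 0 ∧
            ∀ (χ : HeckeCharacter K) (n : ℕ), 0 < n →
              (∀ v : HeightOneSpectrum (𝓞 K), χ.IsUnramifiedAt v) →
              ∀ hχ : χ.HasInfinityType (fun _ ↦ (n : ℤ)) (fun _ ↦ -(n : ℤ)),
                ∀ r : FramedGaloisRep K (PadicAlgCl 3) 1, IsPAdicAvatarOf ι' χ r → FactorsThroughZp κ r →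
                  σ (bdpInterpolationValue 3 f 𝔭 χ n Ω) =
                    d * c ^ n * (e.prod fun v k ↦ (hχ.autConj σ).valueAtUniformizer v ^ k) *
                      bdpInterpolationValue 3 f 𝔭 (hχ.autConj σ) n Ω) ∧
        -- (VR-B_I)|κ: exactness on the inertia subgroup, on the κ-RANGE only (S30-e's clause verbatim)
        (∀ (τ : PadicAlgCl 3 ≃ₐ[ℚ_[3]] PadicAlgCl 3) (σ : ℂ ≃ₐ[ℚ] ℂ),
          (∀ ζ : PadicAlgCl 3, (∃ m : ℕ, 0 < m ∧ ¬ 3 ∣ m ∧ ζ ^ m = 1) → τ ζ = ζ) →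
          (∀ z : PadicAlgCl 3, σ (ι' z) = ι' (τ z)) →
          ∀ (χ : HeckeCharacter K) (n : ℕ), 0 < n →
            (∀ v : HeightOneSpectrum (𝓞 K), χ.IsUnramifiedAt v) →
            ∀ hχ : χ.HasInfinityType (fun _ ↦ (n : ℤ)) (fun _ ↦ -(n : ℤ)),
              ∀ r : FramedGaloisRep K (PadicAlgCl 3) 1, IsPAdicAvatarOf ι' χ r → FactorsThroughZp κ r →
                σ (bdpInterpolationValue 3 f 𝔭 χ n Ω) =
                  bdpInterpolationValue 3 f 𝔭 (hχ.autConj σ) n Ω) := by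
  intro ι' K _ _ 𝔭 κ N _ f hf hN hKiq hHeeg hsplit h3𝔭 hram hdeg hι𝔭 _
  obtain ⟨Ω, hΩ, hA, hB⟩ := hVRloc ι' K 𝔭 f hf hN hKiq hHeeg hsplit h3𝔭 hram hdeg hι𝔭
  refine ⟨Ω, hΩ, fun τ σ hστ ↦ ?_,
    fun τ σ hτ hστ χ n hn hunr hχ _ _ _ ↦ hB τ σ hτ hστ χ n hn hunr hχ⟩
  obtain ⟨c, d, e, hc, hd, h⟩ := hA τ σ hστ
  exact ⟨c, d, e, hc, hd, fun χ n hn hunr hχ _ _ _ ↦ h χ n hn hunr hχ⟩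


/- **K4′-a's statement THROUGH the κ-range form** (kernel consistency check, an `example`; the
statement is `hsiehDescentAt₃_of_localValueReciprocity`, p289959): the comparison's conclusion IS K4″'s
binder `hVRlocκ`. -/
example [W.IsElliptic]
    (hVRloc :
  ∀ (ι' : PadicAlgCl 3 ≃+* ℂ) (K : Type) [Field K] [NumberField K] (𝔭 : HeightOneSpectrum (𝓞 K))
      {N : ℕ} [NeZero N] (f : CuspForm (CongruenceSubgroup.Gamma0 N) 2),
      IsNewformOf W f → W.conductorNorm ℤ = N → IsImaginaryQuadratic K → SatisfiesHeegnerHypothesis N K →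
      ((Ideal.span {(3 : ℤ)}).primesOver (𝓞 K)).ncard = 2 → ((3 : ℕ) : 𝓞 K) ∈ 𝔭.asIdeal →
      𝔭.asIdeal.ramificationIdx (𝓞 ℚ) = 1 → 𝔭.asIdeal.inertiaDeg (𝓞 ℚ) = 1 →
      (∀ (w : InfinitePlace K) (k : 𝓞 K), k ∈ 𝔭.asIdeal ↔ ‖ι'.symm (w.embedding (k : K))‖ < 1) →
      ∃ Ω : ℂ, Ω ≠ 0 ∧
        -- (VR-A_𝔭) cocycle clause on the decomposition group at 𝔭 (transported by ι′); NO support condition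
        (∀ (τ : PadicAlgCl 3 ≃ₐ[ℚ_[3]] PadicAlgCl 3) (σ : ℂ ≃ₐ[ℚ] ℂ),
          (∀ z : PadicAlgCl 3, σ (ι' z) = ι' (τ z)) →
          ∃ (c d : ℂ) (e : HeightOneSpectrum (𝓞 K) →₀ ℤ), c ≠ 0 ∧ d ≠ 0 ∧
            ∀ (χ : HeckeCharacter K) (n : ℕ), 0 < n →
              (∀ v : HeightOneSpectrum (𝓞 K), χ.IsUnramifiedAt v) →
              ∀ hχ : χ.HasInfinityType (fun _ ↦ (n : ℤ)) (fun _ ↦ -(n : ℤ)),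
                σ (bdpInterpolationValue 3 f 𝔭 χ n Ω) =
                  d * c ^ n * (e.prod fun v k ↦ (hχ.autConj σ).valueAtUniformizer v ^ k) *
                    bdpInterpolationValue 3 f 𝔭 (hχ.autConj σ) n Ω) ∧
        -- (VR-B_I) exactness clause on the inertia subgroup (T6's inertia predicate verbatim)
        (∀ (τ : PadicAlgCl 3 ≃ₐ[ℚ_[3]] PadicAlgCl 3) (σ : ℂ ≃ₐ[ℚ] ℂ),
          (∀ ζ : PadicAlgCl 3, (∃ m : ℕ, 0 < m ∧ ¬ 3 ∣ m ∧ ζ ^ m = 1) → τ ζ = ζ) →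
          (∀ z : PadicAlgCl 3, σ (ι' z) = ι' (τ z)) →
          ∀ (χ : HeckeCharacter K) (n : ℕ), 0 < n →
            (∀ v : HeightOneSpectrum (𝓞 K), χ.IsUnramifiedAt v) →
            ∀ hχ : χ.HasInfinityType (fun _ ↦ (n : ℤ)) (fun _ ↦ -(n : ℤ)),
              σ (bdpInterpolationValue 3 f 𝔭 χ n Ω) =
                bdpInterpolationValue 3 f 𝔭 (hχ.autConj σ) n Ω)) :
    HsiehDescentAt₃ W :=
  hsiehDescentAt₃_of_rangeValueReciprocity W (rangeValueReciprocity_of_localValueReciprocity W hVRloc)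

/- **K4's terminal form THROUGH the whole ladder** (an `example`; the statement is
`hsiehDescentAt₃_of_valueReciprocity'`, p287576): (VR) ⟹ (VR_loc) (K4′-b) ⟹ (VR_loc|κ) ⟹ (t) (K4″). -/
example [W.IsElliptic]
    (hVR :
  (∀ (K : Type) [Field K] [NumberField K] (𝔭 : HeightOneSpectrum (𝓞 K)) {N : ℕ} [NeZero N]
      (f : CuspForm (CongruenceSubgroup.Gamma0 N) 2),
      IsNewformOf W f → W.conductorNorm ℤ = N → IsImaginaryQuadratic K → SatisfiesHeegnerHypothesis N K →
      ((Ideal.span {(3 : ℤ)}).primesOver (𝓞 K)).ncard = 2 → ((3 : ℕ) : 𝓞 K) ∈ 𝔭.asIdeal →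
      ∃ Ω : ℂ, Ω ≠ 0 ∧
        -- (VR-A) cocycle clause on Aut(ℂ/K); ideal slot = integer-exponent monomial at primes v ∤ 3 (F-i)
        (∀ σ : ℂ ≃ₐ[ℚ] ℂ, (∀ (φ : K →+* ℂ) (k : K), σ (φ k) = φ k) →
          ∃ (c d : ℂ) (e : HeightOneSpectrum (𝓞 K) →₀ ℤ), c ≠ 0 ∧ d ≠ 0 ∧
            (∀ v ∈ e.support, ((3 : ℕ) : 𝓞 K) ∉ v.asIdeal) ∧
            ∀ (χ : HeckeCharacter K) (n : ℕ), 0 < n →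
              (∀ v : HeightOneSpectrum (𝓞 K), χ.IsUnramifiedAt v) →
              ∀ hχ : χ.HasInfinityType (fun _ ↦ (n : ℤ)) (fun _ ↦ -(n : ℤ)),
                σ (bdpInterpolationValue 3 f 𝔭 χ n Ω) =
                  d * c ^ n * (e.prod fun v k ↦ (hχ.autConj σ).valueAtUniformizer v ^ k) *
                    bdpInterpolationValue 3 f 𝔭 (hχ.autConj σ) n Ω) ∧
        -- (VR-B) exactness clause on Aut(ℂ/F), F ⊇ K a number field unramified above 3
        (∃ F : IntermediateField ℚ ℂ, FiniteDimensional ℚ F ∧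
          (∀ (φ : K →+* ℂ) (k : K), φ k ∈ F) ∧
          (∀ P : Ideal (𝓞 F), P.IsPrime → ((3 : ℕ) : 𝓞 F) ∈ P → P.ramificationIdx (𝓞 ℚ) = 1) ∧
          ∀ σ : ℂ ≃ₐ[ℚ] ℂ, (∀ x : ℂ, x ∈ F → σ x = x) →
            ∀ (χ : HeckeCharacter K) (n : ℕ), 0 < n →
              (∀ v : HeightOneSpectrum (𝓞 K), χ.IsUnramifiedAt v) →
              ∀ hχ : χ.HasInfinityType (fun _ ↦ (n : ℤ)) (fun _ ↦ -(n : ℤ)),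
                σ (bdpInterpolationValue 3 f 𝔭 χ n Ω) =
                  bdpInterpolationValue 3 f 𝔭 (hχ.autConj σ) n Ω))) :
    HsiehDescentAt₃ W :=
  hsiehDescentAt₃_of_rangeValueReciprocity W
    (rangeValueReciprocity_of_localValueReciprocity W (localValueReciprocity_of_valueReciprocity W hVR))

end Summit.BirchSwinnertonDyer.Rank1Residual.X11b.Three
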